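import Summits.NavierStokesRegularity.NavierStokesRegularity.Theorems.SwirlFreeBudgetAxisRegularity
import Summits.NavierStokesRegularity.NavierStokesRegularity.Theorems.AxisymmetricExtremalityAxisymmetricKatoGlobalStubSeregin2020TypeIINoSwirlRegularRepr
import Summits.NavierStokesRegularity.NavierStokesRegularity.Theorems.AxisymmetricExtremalityAxisymmetricKatoGlobalStubSeregin2020TypeIINoSwirlCore
import Literature.Analysis.FluidPDE.AxisymmetricSingularSetOnAxis
import Literature.Analysis.FluidPDE.RusinSverakBackwardRegularityHolds
import Literature.Analysis.FluidPDE.AxisymmetricVorticityTransport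
import HarnessLib

/-!
# SwirlFreeBudget, crux K-18.2 (T-18.5), step "suitable-weak → smooth": every interior point of an
# axis-centred cylinder is regular, and the GLOBALLY axisymmetric swirl-free smooth representative
# (seat nsreg-p4 g12)

Support file for the DORMANT route `SwirlThreshold` (crux stmt-NavierStokesRegularity-2002) and
planner nsreg-p2's ROUND-18 assembly `EtaMoserBound → SwirlFreePolynomialBound`
(`…Theorems.SwirlFreeBudget`).  Continues `…SwirlFreeBudgetAxisRegularity`:

* `isRegularPoint_of_hasNoSwirl` — for `(v, q)` suitable on the axis-centred open cylinder
  `Q(z₀, R)`, in Albritton–Barker's ball class on every sub-cylinder, with axisymmetric swirl-free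
  slices and axisymmetric pressure, EVERY point of `Q(z₀, R)` is a regular point: off the axis by
  CKN for axisymmetric solutions (`isRegularPoint_of_cylRadius_ne_zero`), on the axis by
  `exists_eLpNorm_lt_top_of_hasNoSwirl_axis` and centred regularity
  (`isRegularPoint_of_eLpNorm_parabolicCylinder_lt_top_holds`, Robinson–Rodrigo–Sadowski Cor. 15.6);
* `exists_smooth_axisymmetric_hasNoSwirl_repr` — hence `v` has on `Q(z₀, R)` a representative `V`
  in the Seregin–Zajączkowski smooth class (`exists_isSmoothAxisymmetricSolutionOn_of_regular`)
  which, extended by `0` off the cylinder, is axisymmetric and swirl free at EVERY point of space–time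
  — the input format of the smooth-case core `smooth_velocity_bound_of_gauges`;
* `cknA_le_cknAEss_of_continuousOn_cylinder` — for a field continuous on `Q(z, r)` CKN's `sup_t`
  scaled energy is at most Albritton–Barker's `esssup_t` one (Fatou; the tree's
  `cknA_le_cknAEss_of_continuousOn` asks continuity on the whole slab).

WHAT THIS IS NOT: not NS regularity — qualitative regularity/representative bookkeeping for the
SWIRL-FREE class (classical since 1968) from proved tree theorems; `SwirlFreePolynomialBound`,
`EtaMoserBound` and all hard cores untouched; no crux claim.
-/

namespace Summit.NavierStokesRegularity.NavierStokesRegularity.Theorems.SwirlFreeBudget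

open MeasureTheory Set Filter Topology Metric Function TopologicalSpace
open scoped ENNReal NNReal
open Literature.Analysis Literature.Analysis.FluidPDE
open Literature.Analysis.FluidPDE.SereginZajaczkowski2007
open Summit.NavierStokesRegularity.NavierStokesRegularity.Theorems.AxisymmetricKatoGlobal.EulerScaling

noncomputable section

/-! ### Geometry of axis-centred cylinders -/

/-- A small backward cylinder about an interior point of `Q(z₀, R)` stays inside:
for `z ∈ Q(z₀, R)` there is `r ∈ (0, 1]` with `Q(z, r) ⊆ Q(z₀, R)`. -/
theorem exists_parabolicCylinder_subset {z₀ z : ℝ × EuclideanSpace ℝ (Fin 3)} {R : ℝ}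
    (hz : z ∈ parabolicCylinder R z₀) :
    ∃ r : ℝ, 0 < r ∧ r ≤ 1 ∧ parabolicCylinder r z ⊆ parabolicCylinder R z₀ := by
  obtain ⟨ε, hε, hεsub⟩ := Metric.isOpen_iff.1 (isOpen_parabolicCylinder R z₀) z hz
  refine ⟨min ε 1, lt_min hε one_pos, min_le_right _ _, fun y hy => hεsub ?_⟩
  rw [mem_parabolicCylinder] at hy
  rw [mem_ball, Prod.dist_eq, max_lt_iff, Real.dist_eq]
  have h1 : min ε 1 ^ 2 ≤ min ε 1 := by
    have h0 : 0 ≤ min ε 1 := (lt_min hε one_pos).le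
    nlinarith [min_le_right ε 1]
  refine ⟨?_, hy.2.trans_le (min_le_left _ _)⟩
  rw [abs_lt]
  constructor <;> linarith [hy.1.1, hy.1.2, min_le_left ε 1]

/-- Axis-centred cylinders are rotation invariant: for `z₀` on the axis,
`(t, x) ∈ Q(z₀, R) → (t, R_θ x) ∈ Q(z₀, R)`. -/
theorem rotZ_mem_parabolicCylinder_of_axis {z₀ : ℝ × EuclideanSpace ℝ (Fin 3)} {R : ℝ}
    (hz₀ : cylRadius z₀.2 = 0) (θ : ℝ) {z : ℝ × EuclideanSpace ℝ (Fin 3)}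
    (hz : z ∈ parabolicCylinder R z₀) :
    ((z.1, rotZ θ z.2) : ℝ × EuclideanSpace ℝ (Fin 3)) ∈ parabolicCylinder R z₀ := by
  rw [mem_parabolicCylinder] at hz ⊢
  refine ⟨hz.1, ?_⟩
  rw [dist_rotZ_of_axis ((cylRadius_eq_zero_iff z₀.2).1 hz₀)]
  exact hz.2

/-! ### Every interior point is regular -/

/-- **Every point of an axis-centred cylinder is a regular point of a swirl-free axisymmetric
suitable weak solution.**  Hypotheses: `(v, q)` suitable on `Q(z₀, R)` (`z₀` on the axis) and in
Albritton–Barker's ball class on every sub-cylinder `Q(z, r) ⊆ Q(z₀, R)`; all slices of `v`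
axisymmetric and swirl free; the pressure slices axisymmetric on the time window.  Conclusion:
`IsRegularPoint v z` for every `z ∈ Q(z₀, R)` (off the axis: `isRegularPoint_of_cylRadius_ne_zero`;
on the axis: `exists_eLpNorm_lt_top_of_hasNoSwirl_axis` + centred regularity). -/
theorem isRegularPoint_of_hasNoSwirl
    {v : ℝ → EuclideanSpace ℝ (Fin 3) → EuclideanSpace ℝ (Fin 3)}
    {q : ℝ → EuclideanSpace ℝ (Fin 3) → ℝ} {z₀ : ℝ × EuclideanSpace ℝ (Fin 3)} {R : ℝ}
    (hsuit : IsSuitableWeakSolutionOn (parabolicCylinderOpens R z₀) 1 0 v q)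
    (hballs : ∀ z ∈ parabolicCylinder R z₀, ∀ r : ℝ, 0 < r →
      parabolicCylinder r z ⊆ parabolicCylinder R z₀ → IsSuitableWeakSolutionInBall r z v q)
    (hax : ∀ s, IsAxisymmetric (v s)) (hns : ∀ s, HasNoSwirl (v s))
    (hqax : ∀ t ∈ Ioo (z₀.1 - R ^ 2) z₀.1, IsAxisymmetricScalar (q t)) :
    ∀ z ∈ parabolicCylinder R z₀, IsRegularPoint v z := by
  intro z hz
  by_cases hoff : cylRadius z.2 = 0
  · -- on the axis
    obtain ⟨r, hr, -, hsub⟩ := exists_parabolicCylinder_subset hz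
    have hqax' : ∀ t ∈ Ioo (z.1 - r ^ 2) z.1, IsAxisymmetricScalar (q t) := by
      intro t ht
      have hmem : ((t, z.2) : ℝ × EuclideanSpace ℝ (Fin 3)) ∈ parabolicCylinder r z := by
        rw [mem_parabolicCylinder]; exact ⟨ht, by simpa using hr⟩
      exact hqax t (mem_parabolicCylinder.1 (hsub hmem)).1
    obtain ⟨ρ, hρ, hfin⟩ :=
      exists_eLpNorm_lt_top_of_hasNoSwirl_axis hr (hballs z hz r hr hsub) hax hns hqax' hoff
    have hρr : 0 < min ρ r := lt_min hρ hr
    have hsub' : parabolicCylinder (min ρ r) z ⊆ parabolicCylinder R z₀ :=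
      (parabolicCylinder_mono hρr.le (min_le_right _ _) z).trans hsub
    have hfin' : eLpNorm (uncurry v) ∞ (volume.restrict (parabolicCylinder (min ρ r) z)) < ∞ :=
      (eLpNorm_mono_measure _ (Measure.restrict_mono
        (parabolicCylinder_mono hρr.le (min_le_left _ _) z) le_rfl)).trans_lt hfin
    exact isRegularPoint_of_eLpNorm_parabolicCylinder_lt_top_holds _ v q hsuit z hz _ hρr hsub' hfin'
  · -- off the axis: CKN for axisymmetric solutions
    exact isRegularPoint_of_cylRadius_ne_zero one_pos hsuit (isCKNForceOn_zero _)
      (fun w _ => hax w.1) hz hoff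

/-! ### The globally axisymmetric, swirl-free smooth representative -/

/-- **Extension by zero keeps the Seregin–Zajączkowski class.**  If `(V, P)` is in the smooth class
on an open `S` then so is `(S.indicator V, P)` (every clause of the class is local on `S` or sees
`V` only a.e. on `S`). -/
theorem isSmoothAxisymmetricSolutionOn_indicator {S : Opens (ℝ × EuclideanSpace ℝ (Fin 3))}
    {V : ℝ → EuclideanSpace ℝ (Fin 3) → EuclideanSpace ℝ (Fin 3)} {P : ℝ → EuclideanSpace ℝ (Fin 3) → ℝ}
    (hV : IsSmoothAxisymmetricSolutionOn S V P)
    (hSrot : ∀ θ : ℝ, ∀ z ∈ (S : Set (ℝ × EuclideanSpace ℝ (Fin 3))),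
      ((z.1, rotZ θ z.2) : ℝ × EuclideanSpace ℝ (Fin 3)) ∈ (S : Set (ℝ × EuclideanSpace ℝ (Fin 3)))) :
    IsSmoothAxisymmetricSolutionOn S
      (fun t y => (S : Set (ℝ × EuclideanSpace ℝ (Fin 3))).indicator (uncurry V) (t, y)) P := by
  set W : ℝ → EuclideanSpace ℝ (Fin 3) → EuclideanSpace ℝ (Fin 3) :=
    fun t y => (S : Set (ℝ × EuclideanSpace ℝ (Fin 3))).indicator (uncurry V) (t, y) with hW
  have hSo : IsOpen (S : Set (ℝ × EuclideanSpace ℝ (Fin 3))) := S.isOpen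
  -- `W = V` on `S`, pointwise and eventually along slices
  have hWV : ∀ z ∈ (S : Set (ℝ × EuclideanSpace ℝ (Fin 3))), W z.1 z.2 = V z.1 z.2 := fun z hz => by
    simp only [hW, indicator_of_mem hz, uncurry]
  have hslice : ∀ z ∈ (S : Set (ℝ × EuclideanSpace ℝ (Fin 3))), W z.1 =ᶠ[𝓝 z.2] V z.1 := by
    intro z hz
    have ho : IsOpen {y : EuclideanSpace ℝ (Fin 3) | ((z.1, y) : ℝ × EuclideanSpace ℝ (Fin 3)) ∈
        (S : Set (ℝ × EuclideanSpace ℝ (Fin 3)))} :=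
      hSo.preimage (Continuous.prodMk_right z.1)
    filter_upwards [ho.mem_nhds (show z.2 ∈ {y | ((z.1, y) : ℝ × EuclideanSpace ℝ (Fin 3)) ∈
      (S : Set (ℝ × EuclideanSpace ℝ (Fin 3)))} from hz)] with y hy
    exact hWV (z.1, y) hy
  have hae : uncurry V =ᵐ[volume.restrict (S : Set (ℝ × EuclideanSpace ℝ (Fin 3)))] uncurry W := by
    filter_upwards [ae_restrict_mem hSo.measurableSet] with z hz
    simp only [uncurry]
    exact (hWV z hz).symm
  refine ⟨hV.suitable.congr_ae hae (Eventually.of_forall fun _ => rfl), fun θ z hz => ?_,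
    fun z hz => ?_, fun n z hz => ?_⟩
  · -- axial symmetry on `S`
    have h1 := hWV z hz
    have h2 := hWV (z.1, rotZ θ z.2) (hSrot θ z hz)
    simp only at h2
    rw [h2, h1]
    exact hV.axisymmetric θ z hz
  · exact (hV.contDiffAt z hz).congr_of_eventuallyEq (hslice z hz)
  · obtain ⟨U, hU, C, r, hr, hH⟩ := hV.holder n z hz
    refine ⟨U, hU, C, r, hr, fun w hw w' hw' => ?_⟩
    have e : ∀ w ∈ U ∩ (S : Set (ℝ × EuclideanSpace ℝ (Fin 3))),
        iteratedFDeriv ℝ n (W w.1) w.2 = iteratedFDeriv ℝ n (V w.1) w.2 := fun w hw =>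
      ((hslice w hw.2).iteratedFDeriv ℝ n).eq_of_nhds
    simp only [e w hw, e w' hw']
    exact hH w hw w' hw'

/-- **The globally axisymmetric, swirl-free smooth representative.**  Under the hypotheses of
`isRegularPoint_of_hasNoSwirl` (with `z₀` on the axis), `v` has a representative `V` on `Q(z₀, R)`
with `(V, q)` in the Seregin–Zajączkowski smooth class there, `V t` axisymmetric and swirl free at
EVERY point of space–time (the class representative of `exists_isSmoothAxisymmetricSolutionOn_of_regular`,
whose swirl vanishes on the cylinder by `swirl_repr_eq_zero_of_ae`, extended by `0` outside). -/
theorem exists_smooth_axisymmetric_hasNoSwirl_repr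
    {v : ℝ → EuclideanSpace ℝ (Fin 3) → EuclideanSpace ℝ (Fin 3)}
    {q : ℝ → EuclideanSpace ℝ (Fin 3) → ℝ} {z₀ : ℝ × EuclideanSpace ℝ (Fin 3)} {R : ℝ}
    (hz₀ : cylRadius z₀.2 = 0)
    (hsuit : IsSuitableWeakSolutionOn (parabolicCylinderOpens R z₀) 1 0 v q)
    (hballs : ∀ z ∈ parabolicCylinder R z₀, ∀ r : ℝ, 0 < r →
      parabolicCylinder r z ⊆ parabolicCylinder R z₀ → IsSuitableWeakSolutionInBall r z v q)
    (hax : ∀ s, IsAxisymmetric (v s)) (hns : ∀ s, HasNoSwirl (v s))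
    (hqax : ∀ t ∈ Ioo (z₀.1 - R ^ 2) z₀.1, IsAxisymmetricScalar (q t)) :
    ∃ V : ℝ → EuclideanSpace ℝ (Fin 3) → EuclideanSpace ℝ (Fin 3),
      IsSmoothAxisymmetricSolutionOn (parabolicCylinderOpens R z₀) V q ∧
      uncurry v =ᵐ[volume.restrict (parabolicCylinder R z₀)] uncurry V ∧
      (∀ t, IsAxisymmetric (V t)) ∧ (∀ t, HasNoSwirl (V t)) := by
  set S : Opens (ℝ × EuclideanSpace ℝ (Fin 3)) := parabolicCylinderOpens R z₀ with hS
  have hSrot : ∀ θ : ℝ, ∀ z ∈ (S : Set (ℝ × EuclideanSpace ℝ (Fin 3))),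
      ((z.1, rotZ θ z.2) : ℝ × EuclideanSpace ℝ (Fin 3)) ∈ (S : Set (ℝ × EuclideanSpace ℝ (Fin 3))) :=
    fun θ z hz => rotZ_mem_parabolicCylinder_of_axis hz₀ θ hz
  have hreg := isRegularPoint_of_hasNoSwirl hsuit hballs hax hns hqax
  obtain ⟨V, hV, hae⟩ := exists_isSmoothAxisymmetricSolutionOn_of_regular (Q := S) (S := S) hsuit
    (fun z _ => hax z.1) le_rfl hreg hSrot
  have hsw0 : ∀ z ∈ (S : Set (ℝ × EuclideanSpace ℝ (Fin 3))), swirl (V z.1) z.2 = 0 :=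
    swirl_repr_eq_zero_of_ae hV hae (Eventually.of_forall fun z => hns z.1 z.2)
  set W : ℝ → EuclideanSpace ℝ (Fin 3) → EuclideanSpace ℝ (Fin 3) :=
    fun t y => (S : Set (ℝ × EuclideanSpace ℝ (Fin 3))).indicator (uncurry V) (t, y) with hW
  have hWin : ∀ z ∈ (S : Set (ℝ × EuclideanSpace ℝ (Fin 3))), W z.1 z.2 = V z.1 z.2 := fun z hz => by
    simp only [hW, indicator_of_mem hz, uncurry]
  have hWout : ∀ z ∉ (S : Set (ℝ × EuclideanSpace ℝ (Fin 3))), W z.1 z.2 = 0 := fun z hz => by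
    simp only [hW, indicator_of_notMem hz]
  refine ⟨W, isSmoothAxisymmetricSolutionOn_indicator hV hSrot, ?_, fun t θ y => ?_, fun t y => ?_⟩
  · filter_upwards [hae, ae_restrict_mem (isOpen_parabolicCylinder R z₀).measurableSet] with z hz hzS
    rw [hz]
    exact (hWin z hzS).symm
  · -- global axial symmetry of the slices
    by_cases hy : ((t, y) : ℝ × EuclideanSpace ℝ (Fin 3)) ∈ (S : Set (ℝ × EuclideanSpace ℝ (Fin 3)))
    · have h1 := hWin (t, y) hy
      have h2 := hWin (t, rotZ θ y) (hSrot θ (t, y) hy)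
      simp only at h1 h2
      rw [h1, h2]
      exact hV.axisymmetric θ (t, y) hy
    · have hy' : ((t, rotZ θ y) : ℝ × EuclideanSpace ℝ (Fin 3)) ∉
          (S : Set (ℝ × EuclideanSpace ℝ (Fin 3))) := by
        intro h
        have h' := hSrot (-θ) (t, rotZ θ y) h
        simp only at h'
        rw [← rotZ_add, neg_add_cancel, rotZ_zero] at h'
        exact hy h'
      have h1 := hWout (t, y) hy
      have h2 := hWout (t, rotZ θ y) hy'
      simp only at h1 h2
      rw [h1, h2, ← rotZL_apply, map_zero]
  · -- no swirl at every point
    by_cases hy : ((t, y) : ℝ × EuclideanSpace ℝ (Fin 3)) ∈ (S : Set (ℝ × EuclideanSpace ℝ (Fin 3)))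
    · have h1 := hWin (t, y) hy
      simp only at h1
      have h0 := hsw0 (t, y) hy
      simp only [swirl] at h0 ⊢
      rw [h1]
      exact h0
    · have h1 := hWout (t, y) hy
      simp only at h1
      simp only [swirl, h1, PiLp.zero_apply, mul_zero, sub_zero]

/-! ### `sup_t ≤ esssup_t` for the scaled energy of a field continuous on the cylinder -/

/-- **For a field continuous on the open cylinder `Q(z, r)`, CKN's scaled energy `A` (genuine
`sup_t`, `cknA`) is at most Albritton–Barker's `esssup_t` version (`cknAEss`)**: the slice energy
`t ↦ ∫_{B(x,r)} |u(t)|²` is lower semicontinuous on the time window (Fatou), so each of its values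
is approached on a set of times of positive measure.  (Local form of the tree's
`cknA_le_cknAEss_of_continuousOn`, which assumes continuity on the whole slab.) -/
theorem cknA_le_cknAEss_of_continuousOn_cylinder
    {u : ℝ → EuclideanSpace ℝ (Fin 3) → EuclideanSpace ℝ (Fin 3)} {r : ℝ}
    {z : ℝ × EuclideanSpace ℝ (Fin 3)} (hcont : ContinuousOn (uncurry u) (parabolicCylinder r z)) :
    cknA r z u ≤ cknAEss r z u := by
  unfold cknA cknAEss
  set I : Set ℝ := Ioo (z.1 - r ^ 2) z.1 with hI
  set B : Set (EuclideanSpace ℝ (Fin 3)) := ball z.2 r with hB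
  set Gf : ℝ → ℝ≥0∞ := fun s => ∫⁻ x in B, ‖u s x‖ₑ ^ 2 with hGf
  have hconst : (fun s => (ENNReal.ofReal r)⁻¹ * ∫⁻ x in B, ‖u s x‖ₑ ^ 2) =
      fun s => (ENNReal.ofReal r)⁻¹ * Gf s := rfl
  rw [hconst, ENNReal.essSup_const_mul]
  refine iSup₂_le fun t ht => ?_
  set μ : Measure ℝ := volume.restrict I with hμ
  suffices key : Gf t ≤ essSup Gf μ from mul_le_mul' le_rfl key
  by_contra hlt
  push Not at hlt
  have htI : t ∈ I := ht
  -- slices are continuous on the ball at times of `I`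
  have hslice : ∀ s ∈ I, ContinuousOn (u s) B := fun s hs =>
    hcont.comp (Continuous.prodMk_right s).continuousOn fun x hx => ⟨hs, hx⟩
  have hmeas : ∀ i : I, AEMeasurable (fun x => ‖u i.1 x‖ₑ ^ 2) (volume.restrict B) := fun i =>
    ((hslice i.1 i.2).aestronglyMeasurable measurableSet_ball).aemeasurable.enorm.pow_const 2
  have hFatou := lintegral_liminf_le' (μ := volume.restrict B) (u := 𝓝 (⟨t, htI⟩ : I)) hmeas
  have hpt : ∀ x ∈ B, liminf (fun i : I => ‖u i.1 x‖ₑ ^ 2) (𝓝 ⟨t, htI⟩) = ‖u t x‖ₑ ^ 2 := by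
    intro x hx
    refine Tendsto.liminf_eq ?_
    have hca : ContinuousAt (uncurry u) (t, x) :=
      hcont.continuousAt ((isOpen_parabolicCylinder r z).mem_nhds ⟨ht, hx⟩)
    have h1 : Tendsto (fun s : ℝ => uncurry u (s, x)) (𝓝 t) (𝓝 (uncurry u (t, x))) :=
      hca.tendsto.comp ((continuous_id.prodMk continuous_const).tendsto t)
    have h2 : Tendsto (fun i : I => u i.1 x) (𝓝 ⟨t, htI⟩) (𝓝 (u t x)) :=
      h1.comp (continuous_subtype_val.tendsto _)
    exact ENNReal.Tendsto.pow h2.enorm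
  rw [setLIntegral_congr_fun measurableSet_ball hpt] at hFatou
  have hev : ∀ᶠ i : I in 𝓝 ⟨t, htI⟩, essSup Gf μ < Gf i.1 :=
    eventually_lt_of_lt_liminf (hlt.trans_le hFatou)
  rw [eventually_nhds_subtype_iff I ⟨t, htI⟩ (fun s => essSup Gf μ < Gf s),
    isOpen_Ioo.nhdsWithin_eq htI, Metric.eventually_nhds_iff] at hev
  obtain ⟨ε, hε, hball⟩ := hev
  have hpos : 0 < volume (ball t ε ∩ I) :=
    (isOpen_ball.inter isOpen_Ioo).measure_pos volume ⟨t, mem_ball_self hε, htI⟩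
  have hnull : μ {s | essSup Gf μ < Gf s} = 0 := meas_essSup_lt
  have hsub : ball t ε ∩ I ⊆ {s | essSup Gf μ < Gf s} ∩ I := fun s hs => ⟨hball hs.1, hs.2⟩
  rw [hμ, Measure.restrict_apply' measurableSet_Ioo] at hnull
  exact hpos.ne' (measure_mono_null hsub hnull)

end

end Summit.NavierStokesRegularity.NavierStokesRegularity.Theorems.SwirlFreeBudget
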